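import Summits.QuantumFields.YangMills.Theorems.BalabanUVNodesPortS1Sect5AtRecordF1
import Summits.QuantumFields.YangMills.Theorems.BalabanUVNodesPortS1Sect4ChartSmooth

/-!
# NODE O port, row PT-A-2 — F1′ REPAIR AT THE RECORD, PART 2: the NESTING-DISCHARGED rows and the ONE-NAME §5 PACKAGE (twins of FILES `…Sect5RowsNumerics ∕ …Sect5AtRecord`), every
# domain row re-keyed to `{PlaqSmall νD.ε₀}` for a FREE numerics record `νD`; plus the package with the `C²` row discharged by FORMAT⁺ᴳ at level `k` + token [12] (FILE `…Sect4ChartSmooth`)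

CITATION HEADER.  [I] = [Balaban1987RG1]: (1.20)–(1.22) p. 264, (4.14) p. 284, (4.32)–(4.33) p. 289, (5.2)–(5.10) pp. 292–293, (5.36)–(5.44) pp. 297–298, (2.3) p. 265, (2.16)–(2.18)
p. 269; [B11] = [Balaban1985Variational] Thm 1 p. 279; [B7] = [Balaban1985Averaging] Prop. 2 (53) p. 26.  Porter PT-A-2 (`ymgap-nodeO-port-PTA-2`), `--supports stmt-QuantumFields-27930
--as helper`.  Every proof is the gen-2∕3 proof VERBATIM over the F1′ on-domain twins of FILES `…Sect5OnDomainF1 ∕ …Sect5OnDomainF1Perm` (`νD` threaded; `θ.ν.ε₀ ↦ νD.ε₀` in every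
numeric clause and as the `ε₁` of the local-invariance lemmas; the [B11] radius `θ.ν.εreg = a₀`, `θ.εbg = a₀` and `critCfgOfRecord F 2 θ.ν` untouched).  WHY: at `θ := thetaFill F a₀ ε₂₉`
the gen-3 rows read `domAltOfRecord F 2 θ.ν K j` whose radius `θ.ν.ε₀` is pinned to the literal `1` (a `Φf`-unread fill), making the Federbush clause false and `hrows` unsatisfiable
(referee ref-H F1, 2026-08-31); with a FREE `νD` every clause is satisfiable-shaped.
THE DISPLAYED ROWS NOW (suppliers = N-lane ∕ [B11] ∕ lens-1): `0 < νD.ε₀`; for all large `K`: `((dL)²∕4)·νD.ε₀ < δ_Fed`, `C₀(d)·a₀ ≤ ⅓`, `2a₀ ≤ 2δ_SU∕((d+4)L)²`, `2a₀ ≤ νD.ε₀·L²`;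
[B11] E+U at radius `a₀` on `{PlaqSmall νD.ε₀}` at levels `≤ k+1`; (F7a); (F7a-supp); (I19); `PolLimitExists`; `C²` at `0` (or FORMAT⁺ᴳ + [12]); (5.10) where the β-bounds are read.
LOCATED NUMERIC NOTE (not a claim): token [11] of ⁸ supplies E+U on `{PlaqSmall ε₁}` only for `B₃ε₁ ≤ a₀`, `B₃ ≥ 2L²`, while the nesting wants `νD.ε₀ ≥ 2a₀∕L²` — so [11] is NOT the
supplier of these E+U rows; [B11] Thm 1 at `(νD.ε₀, a₀)` is.
HONEST FRAMING.  A re-keying of displayed rows; nothing of Bałaban's estimates asserted, ported or discharged; 27930 signed-open (⁸-Ax-LR4), no claim held; finite 𝕋⁴ at fixed ε — NOT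
continuum∕OS∕Clay; the Yang–Mills mass gap is NOT proved by any of this.
-/

noncomputable section

open scoped Matrix.Norms.L2Operator Topology

namespace Summit.QuantumFields.YangMills.Theorems.BalabanUVNodesPortS1

open Filter MeasureTheory Matrix
open NormedSpace (exp)
open Literature.MathematicalPhysics.QuantumFieldTheory.Balaban1983to89
open Literature.MathematicalPhysics.QuantumFieldTheory.Balaban1983to89.Node00
open Literature.MathematicalPhysics.QuantumFieldTheory.Balaban1983to89.ExpMeanLog (deltaSU)
open Literature.MathematicalPhysics.QuantumFieldTheory.GawedzkiKupiainen1985.PeriodicGleason (Pt unitVec ExpBound deltaIter K)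
open T4Continuum (T4Family)
open Summit.QuantumFields.YangMills.Theorems.K0RecordFormatNames
open B12PolarizationTensor120 (expChart polComp polTensor polTensor_def)
open B12Transverse536 (WardFirst ReflCovariant)
open Beta.PolarizationSign (IndexSymmetric)
open B12Ward59 (ward_fst_kernel)
open B12Sec2to5 (Decay510 betaPrime510)
open B12Rep537 (TaylorData3 ofReal rem538 wilsonQ MQ)
open FederbushMean (deltaFed)
open GaugeField (gaugeAct)
open B12ContinuousTransportInvarianceOn (domAltOfRecord_gaugeAct_mem isOpen_domAltOfRecord)

section Record

variable (F : T4Family) (a₀ ε₂₉ : ℝ) (νD : Stage7Numerics)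

/-- **[F1′ twin: every domain row reads `domAltOfRecord F 2 νD K ·` = `{PlaqSmall νD.ε₀}` for a FREE numerics record `νD`; χ^{Ax}, radii `ν.εreg = εbg = a₀`, `ε₂₉` at `thetaFill` unchanged]** **★★ [I] §5's BUNDLE AT THE RECORD WITH THE NESTING ROWS DISCHARGED**: `B12Carve25Sect5TensorHyp.Hyp` for a family of the record's limiting kernels from [B11] on the domains
(radius `ν.εreg`, levels `≤ k+1`) and at radius `θ.εbg` on `domAlt_{k+1}`, (F7a), (F7a-supp), (I19), the NUMERICS (on `ν.ε₀`, `ν.εreg`, `εbg`, `L`; all large `K`), `PolLimitExists`,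
`C²` at `0`, and the decay (5.10). [cite: Balaban1987RG1, (5.6)-(5.10) pp.292-293, (2.3) p.265; Balaban1985Variational, Thm 1 p.279; Balaban1985Averaging, Prop. 2 (53) p.26] -/
theorem carve25Hyp_recordPlimAx_of_rows₂' {ι' : Type*} (kOf : ι' → ℕ) (vOf : (i : ι') → Fin (kOf i + 1) → ℝ) {C δ₁ : ℝ} (hδ : 0 < δ₁)
    (h510 : ∀ (i : ι') (μ ν : Fin 4), Decay510 (recordPlimAx F a₀ ε₂₉ (kOf i) (vOf i) μ ν) C δ₁)
    (hε₀ : 0 < νD.ε₀) (hεreg : 0 < (thetaFill F a₀ ε₂₉).ν.εreg) (hεbg : 0 < (thetaFill F a₀ ε₂₉).εbg)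
    (hlim : letI θ := thetaFill F a₀ ε₂₉
      letI := θ.instVβ₁; letI := θ.instVβ₂; letI := θ.instιβ
      ∀ i : ι', PolLimitExists F (kOf i + 1) (fun K => recordTermsAx F a₀ ε₂₉ (kOf i) (vOf i) K) θ.ρ8 θ.bV)
    (hC2 : letI θ := thetaFill F a₀ ε₂₉
      letI := θ.instVβ₁; letI := θ.instVβ₂
      ∀ i : ι', ∀ᶠ K in atTop, ContDiffAt ℝ 2 (expChart (recordTermsAx F a₀ ε₂₉ (kOf i) (vOf i) K) θ.ρ8) 0)
    (hrows : letI θ := thetaFill F a₀ ε₂₉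
      ∀ i : ι', ∀ᶠ K in atTop, kOf i + 1 ≤ K ∧
        (((((F.P K).d * (F.P K).L : ℕ) : ℝ)) ^ 2 / 4 * νD.ε₀ < deltaFed (Fin 2) ∧
          (143 * (((((F.P K).d + 4 : ℕ) : ℝ)) ^ 2 / 4) ^ 2) * θ.ν.εreg ≤ 1 / 3 ∧
          2 * θ.ν.εreg ≤ 2 * deltaSU (Fin 2) / ((((F.P K).d + 4) * (F.P K).L : ℕ) : ℝ) ^ 2 ∧ 2 * θ.ν.εreg ≤ νD.ε₀ * ((F.P K).L : ℝ) ^ 2 ∧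
          (143 * (((((F.P K).d + 4 : ℕ) : ℝ)) ^ 2 / 4) ^ 2) * θ.εbg ≤ 1 / 3 ∧
          2 * θ.εbg ≤ 2 * deltaSU (Fin 2) / ((((F.P K).d + 4) * (F.P K).L : ℕ) : ℝ) ^ 2 ∧ 2 * θ.εbg ≤ νD.ε₀ * ((F.P K).L : ℝ) ^ 2) ∧
        (∀ j < kOf i + 1, ∀ W ∈ domAltOfRecord F 2 νD K (j + 1), UkExists F 2 K (j + 1) θ.ν.εreg W ∧ UniqueUkOrbit F 2 K (j + 1) θ.ν.εreg W) ∧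
        (∀ j < kOf i + 1, domAltOfRecord F 2 νD K (j + 1) ⊆
          regSetOfRecord F 2 K j (betaInputOfRecord F 2 (TβOfRecord₁₃ F 2) (chiβOfRecord₁₃Ax F 2 θ) K (T4FlagMemory.extd (vOf i)) j)) ∧
        (∀ j < kOf i + 1, ∀ᵐ U ∂(fieldMeasure (F.P K) j (SU 2)), (avOfRecord F 2 K j).avg U ∈ domAltOfRecord F 2 νD K (j + 1) →
          U ∉ domAltOfRecord F 2 νD K j → chiβOfRecord₁₃Ax F 2 θ K (T4FlagMemory.extd (vOf i)) j U = 0) ∧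
        (∀ j < kOf i + 1, Integrable (betaInputOfRecord F 2 (TβOfRecord₁₃ F 2) (chiβOfRecord₁₃Ax F 2 θ) K (T4FlagMemory.extd (vOf i)) j) (fieldMeasure (F.P K) j (SU 2))) ∧
        (∀ W ∈ domAltOfRecord F 2 νD K (kOf i + 1), UkExists F 2 K (kOf i + 1) θ.εbg W ∧ UniqueUkOrbit F 2 K (kOf i + 1) θ.εbg W)) :
    B12Carve25Sect5TensorHyp.Hyp (fun i : ι' => recordPlimAx F a₀ ε₂₉ (kOf i) (vOf i)) C δ₁ := by
  letI θ := thetaFill F a₀ ε₂₉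
  refine carve25Hyp_recordPlimAx_of_rows' F a₀ ε₂₉ νD kOf vOf hδ h510 hε₀ hlim hC2 fun i => (hrows i).mono fun K hK => ?_
  obtain ⟨hk, ⟨hFed, hreg3, hreg2, hregε₀, hbg3, hbg2, hbgε₀⟩, h11, hF7a, hsupp, hint, htop⟩ := hK
  obtain ⟨hcrit, htop'⟩ := nestings_of_numerics' F θ νD K (kOf i) hεreg hreg3 hreg2 hregε₀ hεbg hbg3 hbg2 hbgε₀ h11 htop
  exact ⟨hk, hFed, h11, hcrit, hF7a, hsupp, hint, htop'⟩

/-- **[F1′ twin: every domain row reads `domAltOfRecord F 2 νD K ·` = `{PlaqSmall νD.ε₀}` for a FREE numerics record `νD`; χ^{Ax}, radii `ν.εreg = εbg = a₀`, `ε₂₉` at `thetaFill` unchanged]** **★ `|β_{k+1}(v)| ≤ β′` AT ONE MEMBER OF THE β-BOX WITH THE NESTING ROWS DISCHARGED.** [cite: Balaban1987RG1, p.264 (β-clause), (5.42) p.297, (5.10) p.293, (2.3) p.265] -/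
theorem abs_betaOfRecord₁₃Ax_le_betaPrime_of_rows₂' (k : ℕ) (v : Fin (k + 1) → ℝ) (hv : v ∈ FlowStep.Box (1 / 2) k) {C δ₁ : ℝ} (hδ : 0 < δ₁)
    (h510 : ∀ μ ν : Fin 4, Decay510 (recordPlimAx F a₀ ε₂₉ k v μ ν) C δ₁)
    (hε₀ : 0 < νD.ε₀) (hεreg : 0 < (thetaFill F a₀ ε₂₉).ν.εreg) (hεbg : 0 < (thetaFill F a₀ ε₂₉).εbg)
    (hlim : letI θ := thetaFill F a₀ ε₂₉
      letI := θ.instVβ₁; letI := θ.instVβ₂; letI := θ.instιβ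
      PolLimitExists F (k + 1) (fun K => recordTermsAx F a₀ ε₂₉ k v K) θ.ρ8 θ.bV)
    (hC2 : letI θ := thetaFill F a₀ ε₂₉
      letI := θ.instVβ₁; letI := θ.instVβ₂
      ∀ᶠ K in atTop, ContDiffAt ℝ 2 (expChart (recordTermsAx F a₀ ε₂₉ k v K) θ.ρ8) 0)
    (hrows : letI θ := thetaFill F a₀ ε₂₉
      ∀ᶠ K in atTop, k + 1 ≤ K ∧
        (((((F.P K).d * (F.P K).L : ℕ) : ℝ)) ^ 2 / 4 * νD.ε₀ < deltaFed (Fin 2) ∧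
          (143 * (((((F.P K).d + 4 : ℕ) : ℝ)) ^ 2 / 4) ^ 2) * θ.ν.εreg ≤ 1 / 3 ∧
          2 * θ.ν.εreg ≤ 2 * deltaSU (Fin 2) / ((((F.P K).d + 4) * (F.P K).L : ℕ) : ℝ) ^ 2 ∧ 2 * θ.ν.εreg ≤ νD.ε₀ * ((F.P K).L : ℝ) ^ 2 ∧
          (143 * (((((F.P K).d + 4 : ℕ) : ℝ)) ^ 2 / 4) ^ 2) * θ.εbg ≤ 1 / 3 ∧
          2 * θ.εbg ≤ 2 * deltaSU (Fin 2) / ((((F.P K).d + 4) * (F.P K).L : ℕ) : ℝ) ^ 2 ∧ 2 * θ.εbg ≤ νD.ε₀ * ((F.P K).L : ℝ) ^ 2) ∧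
        (∀ j < k + 1, ∀ W ∈ domAltOfRecord F 2 νD K (j + 1), UkExists F 2 K (j + 1) θ.ν.εreg W ∧ UniqueUkOrbit F 2 K (j + 1) θ.ν.εreg W) ∧
        (∀ j < k + 1, domAltOfRecord F 2 νD K (j + 1) ⊆
          regSetOfRecord F 2 K j (betaInputOfRecord F 2 (TβOfRecord₁₃ F 2) (chiβOfRecord₁₃Ax F 2 θ) K (T4FlagMemory.extd v) j)) ∧
        (∀ j < k + 1, ∀ᵐ U ∂(fieldMeasure (F.P K) j (SU 2)), (avOfRecord F 2 K j).avg U ∈ domAltOfRecord F 2 νD K (j + 1) →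
          U ∉ domAltOfRecord F 2 νD K j → chiβOfRecord₁₃Ax F 2 θ K (T4FlagMemory.extd v) j U = 0) ∧
        (∀ j < k + 1, Integrable (betaInputOfRecord F 2 (TβOfRecord₁₃ F 2) (chiβOfRecord₁₃Ax F 2 θ) K (T4FlagMemory.extd v) j) (fieldMeasure (F.P K) j (SU 2))) ∧
        (∀ W ∈ domAltOfRecord F 2 νD K (k + 1), UkExists F 2 K (k + 1) θ.εbg W ∧ UniqueUkOrbit F 2 K (k + 1) θ.εbg W)) :
    |betaOfRecord₁₃Ax F 2 (thetaFill F a₀ ε₂₉) k v| ≤ betaPrime510 4 C δ₁ := by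
  letI θ := thetaFill F a₀ ε₂₉
  have hT := taylorData3_recordPlimAx_betaOfRecord₁₃Ax a₀ ε₂₉ (fun _ : Unit => k) (fun _ => v)
    (carve25Hyp_recordPlimAx_of_rows₂' F a₀ ε₂₉ νD (fun _ : Unit => k) (fun _ => v) hδ (fun _ => h510) hε₀ hεreg hεbg (fun _ => hlim) (fun _ => hC2) (fun _ => hrows))
    () hv 0 1
  have h := B12Ineq544Constant.norm_beta_le_betaPrime hδ (h510 0 1) hT (show (0 : Fin 4) ≠ 1 by decide)
  rwa [Complex.norm_real, Real.norm_eq_abs] at h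

/-- **[F1′ twin: every domain row reads `domAltOfRecord F 2 νD K ·` = `{PlaqSmall νD.ε₀}` for a FREE numerics record `νD`; χ^{Ax}, radii `ν.εreg = εbg = a₀`, `ε₂₉` at `thetaFill` unchanged]** **★★ p. 264 «UNIFORMLY BOUNDED» AS `FlowStep.BetaUpperH β′ ½ β` AT THE RECORD WITH THE NESTING ROWS DISCHARGED** — from [B11] on the domains, (F7a), (F7a-supp), (I19), numerics,
`PolLimitExists`, `C²` at `0` and (5.10), each read at every member of the β-box. [cite: Balaban1987RG1, p.264 (β-clause after (1.22)), (5.42) p.297, (5.10) p.293; Balaban1985Variational, Thm 1 p.279] -/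
theorem betaUpperH_betaOfRecord₁₃Ax_of_rows₂' {C δ₁ : ℝ} (hδ : 0 < δ₁)
    (h510 : ∀ (k : ℕ) (v : Fin (k + 1) → ℝ), v ∈ FlowStep.Box (1 / 2) k → ∀ μ ν : Fin 4, Decay510 (recordPlimAx F a₀ ε₂₉ k v μ ν) C δ₁)
    (hε₀ : 0 < νD.ε₀) (hεreg : 0 < (thetaFill F a₀ ε₂₉).ν.εreg) (hεbg : 0 < (thetaFill F a₀ ε₂₉).εbg)
    (hlim : letI θ := thetaFill F a₀ ε₂₉
      letI := θ.instVβ₁; letI := θ.instVβ₂; letI := θ.instιβ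
      ∀ (k : ℕ) (v : Fin (k + 1) → ℝ), v ∈ FlowStep.Box (1 / 2) k → PolLimitExists F (k + 1) (fun K => recordTermsAx F a₀ ε₂₉ k v K) θ.ρ8 θ.bV)
    (hC2 : letI θ := thetaFill F a₀ ε₂₉
      letI := θ.instVβ₁; letI := θ.instVβ₂
      ∀ (k : ℕ) (v : Fin (k + 1) → ℝ), v ∈ FlowStep.Box (1 / 2) k → ∀ᶠ K in atTop, ContDiffAt ℝ 2 (expChart (recordTermsAx F a₀ ε₂₉ k v K) θ.ρ8) 0)
    (hrows : letI θ := thetaFill F a₀ ε₂₉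
      ∀ (k : ℕ) (v : Fin (k + 1) → ℝ), v ∈ FlowStep.Box (1 / 2) k → ∀ᶠ K in atTop, k + 1 ≤ K ∧
        (((((F.P K).d * (F.P K).L : ℕ) : ℝ)) ^ 2 / 4 * νD.ε₀ < deltaFed (Fin 2) ∧
          (143 * (((((F.P K).d + 4 : ℕ) : ℝ)) ^ 2 / 4) ^ 2) * θ.ν.εreg ≤ 1 / 3 ∧
          2 * θ.ν.εreg ≤ 2 * deltaSU (Fin 2) / ((((F.P K).d + 4) * (F.P K).L : ℕ) : ℝ) ^ 2 ∧ 2 * θ.ν.εreg ≤ νD.ε₀ * ((F.P K).L : ℝ) ^ 2 ∧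
          (143 * (((((F.P K).d + 4 : ℕ) : ℝ)) ^ 2 / 4) ^ 2) * θ.εbg ≤ 1 / 3 ∧
          2 * θ.εbg ≤ 2 * deltaSU (Fin 2) / ((((F.P K).d + 4) * (F.P K).L : ℕ) : ℝ) ^ 2 ∧ 2 * θ.εbg ≤ νD.ε₀ * ((F.P K).L : ℝ) ^ 2) ∧
        (∀ j < k + 1, ∀ W ∈ domAltOfRecord F 2 νD K (j + 1), UkExists F 2 K (j + 1) θ.ν.εreg W ∧ UniqueUkOrbit F 2 K (j + 1) θ.ν.εreg W) ∧
        (∀ j < k + 1, domAltOfRecord F 2 νD K (j + 1) ⊆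
          regSetOfRecord F 2 K j (betaInputOfRecord F 2 (TβOfRecord₁₃ F 2) (chiβOfRecord₁₃Ax F 2 θ) K (T4FlagMemory.extd v) j)) ∧
        (∀ j < k + 1, ∀ᵐ U ∂(fieldMeasure (F.P K) j (SU 2)), (avOfRecord F 2 K j).avg U ∈ domAltOfRecord F 2 νD K (j + 1) →
          U ∉ domAltOfRecord F 2 νD K j → chiβOfRecord₁₃Ax F 2 θ K (T4FlagMemory.extd v) j U = 0) ∧
        (∀ j < k + 1, Integrable (betaInputOfRecord F 2 (TβOfRecord₁₃ F 2) (chiβOfRecord₁₃Ax F 2 θ) K (T4FlagMemory.extd v) j) (fieldMeasure (F.P K) j (SU 2))) ∧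
        (∀ W ∈ domAltOfRecord F 2 νD K (k + 1), UkExists F 2 K (k + 1) θ.εbg W ∧ UniqueUkOrbit F 2 K (k + 1) θ.εbg W)) :
    FlowStep.BetaUpperH (betaPrime510 4 C δ₁) (1 / 2) (betaOfRecord₁₃Ax F 2 (thetaFill F a₀ ε₂₉)) := fun k v hv =>
  (le_abs_self _).trans (abs_betaOfRecord₁₃Ax_le_betaPrime_of_rows₂' F a₀ ε₂₉ νD k v hv hδ (h510 k v hv) hε₀ hεreg hεbg (hlim k v hv) (hC2 k v hv) (hrows k v hv))

/-- **[F1′ twin: every domain row reads `domAltOfRecord F 2 νD K ·` = `{PlaqSmall νD.ε₀}` for a FREE numerics record `νD`; χ^{Ax}, radii `ν.εreg = εbg = a₀`, `ε₂₉` at `thetaFill` unchanged]** **★★★ [I] §5 (with (4.14) and (A4)) AT THE RE-CENTRED RECORD FROM ONE SET OF ROWS**: with `θ := thetaFill F a₀ ε₂₉`, `g := extd v`, assume `0 < νD.ε₀`, `0 < θ.ν.εreg`,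
`0 < θ.εbg`, the limit (1.21) exists, and for all large `K`: the chart is `C²` at `0`, `k + 1 ≤ K`, the NUMERICS, [B11] Thm 1 on the domains (radius `ν.εreg`, levels `≤ k+1`) and
at radius `θ.εbg` on `domAlt_{k+1}`, (F7a), (F7a-supp), (I19).  THEN: (5.8)₂ `IndexSymmetric`, (5.6) `PermCovariant`, (5.7) `ReflCovariant` and (5.9)₁ `WardFirst` hold for
`recordPlimAx F a₀ ε₂₉ k v`; and for all large `K`: (4.14) `D(expChart)(0) = 0`, (A4) `Π^{ab}_{μν}(x,y) = 0` (`a ≠ b`) and `Π^{aa}_{μν}(x,y) = Π_{μν}(x,y)`, (5.4) `Π_{μν}(x+a, y+a) = Π_{μν}(x, y)`.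
[cite: Balaban1987RG1, (4.14) p.284, (4.32)-(4.33) p.289, (1.20)-(1.21) p.264, (5.2)-(5.9) pp.292-293; Balaban1985Variational, Thm 1 p.279; Balaban1985Averaging, Prop. 2 (53) p.26] -/
theorem sect5_recordPlimAx_of_rows₂' (k : ℕ) (v : Fin (k + 1) → ℝ)
    (hε₀ : 0 < νD.ε₀) (hεreg : 0 < (thetaFill F a₀ ε₂₉).ν.εreg) (hεbg : 0 < (thetaFill F a₀ ε₂₉).εbg)
    (hlim : letI θ := thetaFill F a₀ ε₂₉
      letI := θ.instVβ₁; letI := θ.instVβ₂; letI := θ.instιβ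
      PolLimitExists F (k + 1) (fun K => recordTermsAx F a₀ ε₂₉ k v K) θ.ρ8 θ.bV)
    (hC2 : letI θ := thetaFill F a₀ ε₂₉
      letI := θ.instVβ₁; letI := θ.instVβ₂
      ∀ᶠ K in atTop, ContDiffAt ℝ 2 (expChart (recordTermsAx F a₀ ε₂₉ k v K) θ.ρ8) 0)
    (hrows : letI θ := thetaFill F a₀ ε₂₉
      ∀ᶠ K in atTop, k + 1 ≤ K ∧
        (((((F.P K).d * (F.P K).L : ℕ) : ℝ)) ^ 2 / 4 * νD.ε₀ < deltaFed (Fin 2) ∧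
          (143 * (((((F.P K).d + 4 : ℕ) : ℝ)) ^ 2 / 4) ^ 2) * θ.ν.εreg ≤ 1 / 3 ∧
          2 * θ.ν.εreg ≤ 2 * deltaSU (Fin 2) / ((((F.P K).d + 4) * (F.P K).L : ℕ) : ℝ) ^ 2 ∧ 2 * θ.ν.εreg ≤ νD.ε₀ * ((F.P K).L : ℝ) ^ 2 ∧
          (143 * (((((F.P K).d + 4 : ℕ) : ℝ)) ^ 2 / 4) ^ 2) * θ.εbg ≤ 1 / 3 ∧
          2 * θ.εbg ≤ 2 * deltaSU (Fin 2) / ((((F.P K).d + 4) * (F.P K).L : ℕ) : ℝ) ^ 2 ∧ 2 * θ.εbg ≤ νD.ε₀ * ((F.P K).L : ℝ) ^ 2) ∧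
        (∀ j < k + 1, ∀ W ∈ domAltOfRecord F 2 νD K (j + 1), UkExists F 2 K (j + 1) θ.ν.εreg W ∧ UniqueUkOrbit F 2 K (j + 1) θ.ν.εreg W) ∧
        (∀ j < k + 1, domAltOfRecord F 2 νD K (j + 1) ⊆
          regSetOfRecord F 2 K j (betaInputOfRecord F 2 (TβOfRecord₁₃ F 2) (chiβOfRecord₁₃Ax F 2 θ) K (T4FlagMemory.extd v) j)) ∧
        (∀ j < k + 1, ∀ᵐ U ∂(fieldMeasure (F.P K) j (SU 2)), (avOfRecord F 2 K j).avg U ∈ domAltOfRecord F 2 νD K (j + 1) →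
          U ∉ domAltOfRecord F 2 νD K j → chiβOfRecord₁₃Ax F 2 θ K (T4FlagMemory.extd v) j U = 0) ∧
        (∀ j < k + 1, Integrable (betaInputOfRecord F 2 (TβOfRecord₁₃ F 2) (chiβOfRecord₁₃Ax F 2 θ) K (T4FlagMemory.extd v) j) (fieldMeasure (F.P K) j (SU 2))) ∧
        (∀ W ∈ domAltOfRecord F 2 νD K (k + 1), UkExists F 2 K (k + 1) θ.εbg W ∧ UniqueUkOrbit F 2 K (k + 1) θ.εbg W)) :
    letI θ := thetaFill F a₀ ε₂₉
    letI := θ.instVβ₁; letI := θ.instVβ₂; letI := θ.instιβ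
    (IndexSymmetric (recordPlimAx F a₀ ε₂₉ k v) ∧ B12Beta.PermCovariant (recordPlimAx F a₀ ε₂₉ k v) ∧ ReflCovariant (recordPlimAx F a₀ ε₂₉ k v) ∧
      WardFirst (recordPlimAx F a₀ ε₂₉ k v)) ∧
    ∀ᶠ K in atTop,
      fderiv ℝ (expChart (recordTermsAx F a₀ ε₂₉ k v K) θ.ρ8) 0 = 0 ∧
      (∀ (μ : Fin (F.P K).d) (x : Site (F.P K) (k + 1)) (ν : Fin (F.P K).d) (y : Site (F.P K) (k + 1)) (i j : θ.ιβ), i ≠ j →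
        polComp ℝ (expChart (recordTermsAx F a₀ ε₂₉ k v K) θ.ρ8) θ.bV μ x i ν y j = 0) ∧
      (∀ (μ : Fin (F.P K).d) (x : Site (F.P K) (k + 1)) (ν : Fin (F.P K).d) (y : Site (F.P K) (k + 1)) (i : θ.ιβ),
        polComp ℝ (expChart (recordTermsAx F a₀ ε₂₉ k v K) θ.ρ8) θ.bV μ x i ν y i = polScalar (recordTermsAx F a₀ ε₂₉ k v K) θ.ρ8 θ.bV μ x ν y) ∧
      (∀ (μ : Fin (F.P K).d) (x : Site (F.P K) (k + 1)) (ν : Fin (F.P K).d) (y a : Site (F.P K) (k + 1)),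
        polScalar (recordTermsAx F a₀ ε₂₉ k v K) θ.ρ8 θ.bV μ (x + a) ν (y + a) = polScalar (recordTermsAx F a₀ ε₂₉ k v K) θ.ρ8 θ.bV μ x ν y) := by
  letI θ := thetaFill F a₀ ε₂₉; letI := θ.instVβ₁; letI := θ.instVβ₂; letI := θ.instιβ
  -- the full rows (nestings discharged) at every large `K`
  have hrows' : ∀ᶠ K in atTop, k + 1 ≤ K ∧ ((((F.P K).d * (F.P K).L : ℕ) : ℝ)) ^ 2 / 4 * νD.ε₀ < deltaFed (Fin 2) ∧
      (∀ j < k + 1, ∀ W ∈ domAltOfRecord F 2 νD K (j + 1), UkExists F 2 K (j + 1) θ.ν.εreg W ∧ UniqueUkOrbit F 2 K (j + 1) θ.ν.εreg W) ∧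
      (∀ j < k + 1, ∀ W ∈ domAltOfRecord F 2 νD K (j + 1), critCfgOfRecord F 2 θ.ν K j W ∈ domAltOfRecord F 2 νD K j) ∧
      (∀ j < k + 1, domAltOfRecord F 2 νD K (j + 1) ⊆
        regSetOfRecord F 2 K j (betaInputOfRecord F 2 (TβOfRecord₁₃ F 2) (chiβOfRecord₁₃Ax F 2 θ) K (T4FlagMemory.extd v) j)) ∧
      (∀ j < k + 1, ∀ᵐ U ∂(fieldMeasure (F.P K) j (SU 2)), (avOfRecord F 2 K j).avg U ∈ domAltOfRecord F 2 νD K (j + 1) →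
        U ∉ domAltOfRecord F 2 νD K j → chiβOfRecord₁₃Ax F 2 θ K (T4FlagMemory.extd v) j U = 0) ∧
      (∀ j < k + 1, Integrable (betaInputOfRecord F 2 (TβOfRecord₁₃ F 2) (chiβOfRecord₁₃Ax F 2 θ) K (T4FlagMemory.extd v) j) (fieldMeasure (F.P K) j (SU 2))) ∧
      (∀ W ∈ domAltOfRecord F 2 νD K (k + 1),
        Averaging.iter (avOfRecord F 2 K) k (Uk F 2 K (k + 1) θ.εbg W) ∈ domAltOfRecord F 2 νD K k ∧
          UkExists F 2 K (k + 1) θ.εbg W ∧ UniqueUkOrbit F 2 K (k + 1) θ.εbg W) := by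
    filter_upwards [hrows] with K hK
    obtain ⟨hk, ⟨hFed, hreg3, hreg2, hregε₀, hbg3, hbg2, hbgε₀⟩, h11, hF7a, hsupp, hint, htop⟩ := hK
    obtain ⟨hcrit, htop'⟩ := nestings_of_numerics' F θ νD K k hεreg hreg3 hreg2 hregε₀ hεbg hbg3 hbg2 hbgε₀ h11 htop
    exact ⟨hk, hFed, h11, hcrit, hF7a, hsupp, hint, htop'⟩
  refine ⟨?_, ?_⟩
  · obtain ⟨hS, hP, hR⟩ := recordPlimAx_symmetries_of_rows' F a₀ ε₂₉ νD k v hε₀ hlim hC2 hrows'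
    exact ⟨hS, hP, hR, wardFirst_recordPlimAx_of_rows' F a₀ ε₂₉ νD k v hε₀ hlim hC2
      (hrows'.mono fun _ hK => ⟨hK.1, hK.2.2.1, hK.2.2.2.2.1, hK.2.2.2.2.2.1, hK.2.2.2.2.2.2.1, hK.2.2.2.2.2.2.2⟩)⟩
  · filter_upwards [hC2, hrows'] with K hC hK
    obtain ⟨hk, -, h11, -, hF7a, hsupp, hint, htop⟩ := hK
    have hN : ∀ (w : GaugeTransf (F.P K) (k + 1) (SU 2)) (W : GaugeField (F.P K) (k + 1) (SU 2)), PlaqSmall νD.ε₀ W →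
        mergedTermT F 2 (TβOfRecord₁₃ F 2) (chiβOfRecord₁₃Ax F 2 θ) θ.εbg K (T4FlagMemory.extd v) k (gaugeAct w W) =
          mergedTermT F 2 (TβOfRecord₁₃ F 2) (chiβOfRecord₁₃Ax F 2 θ) θ.εbg K (T4FlagMemory.extd v) k W :=
      fun w W hW => mergedTermT_gaugeAct_recordAx_of_rows' F θ νD θ.εbg K (T4FlagMemory.extd v) hk h11 hF7a hsupp hint htop w W hW
    have hT : ∀ (a : Site (F.P K) (k + 1)) (W : GaugeField (F.P K) (k + 1) (SU 2)), PlaqSmall νD.ε₀ W →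
        mergedTermT F 2 (TβOfRecord₁₃ F 2) (chiβOfRecord₁₃Ax F 2 θ) θ.εbg K (T4FlagMemory.extd v) k (W.translate a) =
          mergedTermT F 2 (TβOfRecord₁₃ F 2) (chiβOfRecord₁₃Ax F 2 θ) θ.εbg K (T4FlagMemory.extd v) k W := by
      intro a W hW
      have hWD : W ∈ domAltOfRecord F 2 νD K (k + 1) := (mem_domAltOfRecord_iff F 2 νD K (k + 1) W).2 hW
      have hWa : W.translate a ∈ domAltOfRecord F 2 νD K (k + 1) := (translate_mem_domAltOfRecord_iff K νD (k + 1) a W).2 hWD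
      exact mergedTermT_translate_on_recordAx' θ νD K (T4FlagMemory.extd v) θ.εbg hk a h11 hF7a hsupp hint hWD (htop W hWD).1 (htop W hWD).2.1 (htop _ hWa).2.2
    exact ⟨fderiv_recordTermsAx_eq_zero_of_local F a₀ ε₂₉ k v K hε₀ (hC.differentiableAt (by norm_num)) hN,
      fun μ x ν y i j hij => polComp_recordTermsAx_offDiag F a₀ ε₂₉ k v K hε₀ (fun u => hN (fun _ => u)) μ x ν y hij,
      fun μ x ν y i => polComp_recordTermsAx_diag F a₀ ε₂₉ k v K hε₀ (fun u => hN (fun _ => u)) μ x ν y i,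
      fun μ x ν y a => polScalar_recordTermsAx_translate_of_local F a₀ ε₂₉ k v K hε₀ hT μ x ν y a⟩

/-- **[F1′ twin: every domain row reads `{PlaqSmall νD.ε₀}` for a FREE numerics record `νD`]** **★★★ THE §5 PACKAGE AT THE RECORD FROM FORMAT⁺ᴳ + [12] + THE N09-SHAPE ROWS** — `sect5_recordPlimAx_of_rows₂'` with its `C²`-at-`0` row supplied by
`eventually_contDiffAt_expChart_recordTermsAx_of_formatPlusG`: the symmetry∕Ward conjunction (5.6)–(5.9) for `recordPlimAx F a₀ ε₂₉ k v` and, for all large volumes, (4.14), (A4) and (5.4).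
[cite: Balaban1987RG1, (1.6)–(1.7) p.261, (1.18) p.263, (1.20)–(1.22) p.264, (4.14) p.284, (4.32)–(4.33) p.289, (5.2)–(5.9) pp.292–293; Balaban1985Variational, Prop. 9 p.309] -/
theorem sect5_recordPlimAx_of_formatPlusG_rows' (Mc k : ℕ) (v : Fin (k + 1) → ℝ) {α₀ α₁ E₀ κ : ℝ} (hα₀ : 0 < α₀) (hα₁ : 0 < α₁)
    (hε₀ : 0 < νD.ε₀) (hεreg : 0 < (thetaFill F a₀ ε₂₉).ν.εreg) (hεbg : 0 < (thetaFill F a₀ ε₂₉).εbg)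
    (hF : letI θ := thetaFill F a₀ ε₂₉; letI := θ.instVβ₁; letI := θ.instVβ₂; letI := θ.instιβ;
      B12FormatPlus.FormatPlusG (fun n => recordDomSys F Mc k (recordK₀ F Mc k + n)) (fun n => recordBondCount F (recordK₀ F Mc k + n))
        (fun n => recordAct F (recordK₀ F Mc k + n)) (fun n => recordUc F Mc k α₀ α₁ (recordK₀ F Mc k + n)) (fun n => recordCoords F Mc k (recordK₀ F Mc k + n))
        (fun n => recordChartDimJ F (recordK₀ F Mc k + n)) (fun n => recordChartJ F Mc k (recordK₀ F Mc k + n))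
        (fun n => recordΦfAx F a₀ ε₂₉ k v (recordK₀ F Mc k + n)) (fun n => recordEmbJ F θ k (recordK₀ F Mc k + n))
        (fun n => recordWrapCtr F Mc k (recordK₀ F Mc k + n)) (fun n => recordDomEmbCtr F Mc k (recordK₀ F Mc k + n))
        (fun n _ => recordCoordProjCtr F (recordK₀ F Mc k + n)) E₀ κ)
    (hreg : letI θ := thetaFill F a₀ ε₂₉; letI := θ.instVβ₁; letI := θ.instVβ₂; letI := θ.instιβ;
      ∀ n : ℕ, AnalyticAt ℝ (fun B : recordW F a₀ ε₂₉ k (recordK₀ F Mc k + n) =>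
        fun (b : PBond (F.P (recordK₀ F Mc k + n)) 0) (i i' : Fin 2) =>
          ((recordBgField F θ k (recordK₀ F Mc k + n) B b : SU 2) : Matrix (Fin 2) (Fin 2) ℂ) i i') 0)
    (hlim : letI θ := thetaFill F a₀ ε₂₉
      letI := θ.instVβ₁; letI := θ.instVβ₂; letI := θ.instιβ
      PolLimitExists F (k + 1) (fun K => recordTermsAx F a₀ ε₂₉ k v K) θ.ρ8 θ.bV)
    (hrows : letI θ := thetaFill F a₀ ε₂₉
      ∀ᶠ K in atTop, k + 1 ≤ K ∧
        (((((F.P K).d * (F.P K).L : ℕ) : ℝ)) ^ 2 / 4 * νD.ε₀ < deltaFed (Fin 2) ∧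
          (143 * (((((F.P K).d + 4 : ℕ) : ℝ)) ^ 2 / 4) ^ 2) * θ.ν.εreg ≤ 1 / 3 ∧
          2 * θ.ν.εreg ≤ 2 * deltaSU (Fin 2) / ((((F.P K).d + 4) * (F.P K).L : ℕ) : ℝ) ^ 2 ∧ 2 * θ.ν.εreg ≤ νD.ε₀ * ((F.P K).L : ℝ) ^ 2 ∧
          (143 * (((((F.P K).d + 4 : ℕ) : ℝ)) ^ 2 / 4) ^ 2) * θ.εbg ≤ 1 / 3 ∧
          2 * θ.εbg ≤ 2 * deltaSU (Fin 2) / ((((F.P K).d + 4) * (F.P K).L : ℕ) : ℝ) ^ 2 ∧ 2 * θ.εbg ≤ νD.ε₀ * ((F.P K).L : ℝ) ^ 2) ∧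
        (∀ j < k + 1, ∀ W ∈ domAltOfRecord F 2 νD K (j + 1), UkExists F 2 K (j + 1) θ.ν.εreg W ∧ UniqueUkOrbit F 2 K (j + 1) θ.ν.εreg W) ∧
        (∀ j < k + 1, domAltOfRecord F 2 νD K (j + 1) ⊆
          regSetOfRecord F 2 K j (betaInputOfRecord F 2 (TβOfRecord₁₃ F 2) (chiβOfRecord₁₃Ax F 2 θ) K (T4FlagMemory.extd v) j)) ∧
        (∀ j < k + 1, ∀ᵐ U ∂(fieldMeasure (F.P K) j (SU 2)), (avOfRecord F 2 K j).avg U ∈ domAltOfRecord F 2 νD K (j + 1) →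
          U ∉ domAltOfRecord F 2 νD K j → chiβOfRecord₁₃Ax F 2 θ K (T4FlagMemory.extd v) j U = 0) ∧
        (∀ j < k + 1, Integrable (betaInputOfRecord F 2 (TβOfRecord₁₃ F 2) (chiβOfRecord₁₃Ax F 2 θ) K (T4FlagMemory.extd v) j) (fieldMeasure (F.P K) j (SU 2))) ∧
        (∀ W ∈ domAltOfRecord F 2 νD K (k + 1), UkExists F 2 K (k + 1) θ.εbg W ∧ UniqueUkOrbit F 2 K (k + 1) θ.εbg W)) :
    letI θ := thetaFill F a₀ ε₂₉
    letI := θ.instVβ₁; letI := θ.instVβ₂; letI := θ.instιβ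
    (IndexSymmetric (recordPlimAx F a₀ ε₂₉ k v) ∧ B12Beta.PermCovariant (recordPlimAx F a₀ ε₂₉ k v) ∧ ReflCovariant (recordPlimAx F a₀ ε₂₉ k v) ∧
      WardFirst (recordPlimAx F a₀ ε₂₉ k v)) ∧
    ∀ᶠ K in atTop,
      fderiv ℝ (expChart (recordTermsAx F a₀ ε₂₉ k v K) θ.ρ8) 0 = 0 ∧
      (∀ (μ : Fin (F.P K).d) (x : Site (F.P K) (k + 1)) (ν : Fin (F.P K).d) (y : Site (F.P K) (k + 1)) (i j : θ.ιβ), i ≠ j →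
        polComp ℝ (expChart (recordTermsAx F a₀ ε₂₉ k v K) θ.ρ8) θ.bV μ x i ν y j = 0) ∧
      (∀ (μ : Fin (F.P K).d) (x : Site (F.P K) (k + 1)) (ν : Fin (F.P K).d) (y : Site (F.P K) (k + 1)) (i : θ.ιβ),
        polComp ℝ (expChart (recordTermsAx F a₀ ε₂₉ k v K) θ.ρ8) θ.bV μ x i ν y i = polScalar (recordTermsAx F a₀ ε₂₉ k v K) θ.ρ8 θ.bV μ x ν y) ∧
      (∀ (μ : Fin (F.P K).d) (x : Site (F.P K) (k + 1)) (ν : Fin (F.P K).d) (y a : Site (F.P K) (k + 1)),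
        polScalar (recordTermsAx F a₀ ε₂₉ k v K) θ.ρ8 θ.bV μ (x + a) ν (y + a) = polScalar (recordTermsAx F a₀ ε₂₉ k v K) θ.ρ8 θ.bV μ x ν y) :=
  sect5_recordPlimAx_of_rows₂' F a₀ ε₂₉ νD k v hε₀ hεreg hεbg hlim
    (eventually_contDiffAt_expChart_recordTermsAx_of_formatPlusG F a₀ ε₂₉ Mc k v hα₀ hα₁ hF hreg 2) hrows

end Record

end Summit.QuantumFields.YangMills.Theorems.BalabanUVNodesPortS1

end
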